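import Literature.AnabelianGeometry.EtaleTheta.ThetaCoversAxOfSetting
import Literature.AnabelianGeometry.EtaleTheta.Discharge.Sec2SplittingOfSection
import Literature.AnabelianGeometry.EtaleTheta.SettingModelChiMuTwoInversionCusp
import Literature.AnabelianGeometry.EtaleTheta.SettingModelChiKummerDataCusp
import HarnessLib

/-!
# The `CoverDataAx` of an [EtTh] §1 theta setting from a SECTION of `Π^tp_X ↠ G_K` — the mod-`l` cusp datum
# `D̄_x := Δ̄_Θ · s(G_K)` (no hIx, no geometric cusp), and its instance at the Kummer-carrying inversion model `χ′`

S. Mochizuki, *The étale theta function and its Frobenioid-theoretic manifestations*, Publ. RIMS **45** (2009) [EtTh], §2,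
discussion preceding Def. 2.1, PRIMS PDF p. 35 (printed 261): «we have an exact sequence `1 → Δ̄_Θ → D̄_x → G_K → 1`»,
«the inertia group `I_x ⊆ D_x` … isomorphically onto `Δ̄_Θ`»; Prop. 2.2 (ii) p. 37 «the `H¹(G_K, Δ̄_Θ)`-torsor of splittings»
[cite: MochizukiEtTh2009, Def 2.1 p.35]. Cell abc-iut, layer L2, seat abc-iut-L2-t10 (gen 6) — the `PiCData.coverDataAx`
constructor lineage (gen 4, `ThetaCoversAxOfSetting`), row «COVERDATAAX FROM A SECTION» (self-named 13:26Z; note N1 to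
abc-iut-L2-d3 g6's R312).

WHY. abc-iut-L2-t2's `ThetaCovers.CoverData` carries «subgroups of quotients as their inverse images in `Π_C`»; of the cusp datum
it asks only `Dx ≤ PiX`, `aug|Dx` onto `G_K`, and `(Dx ⊓ Ker aug) ⊔ barKer = barTheta`. Gen 4's `PiCData.coverDataAx` feeds
`Dx := cl(incl(toHat(D.decomp x)))` — the model's GEOMETRIC decomposition group — and therefore needs the binder hIx
(«`I_x ⥲ Δ̄_Θ`»), which FAILS at every χ-model (toral cusp; gen 5 `not_hIx_modelχ'`) and holds only at the untwisted `modelκ′`,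
where in turn no Kummer / étale-theta data exist (gen 6 K7 `modelκ'_isEmpty_kummerData`). THIS FILE feeds instead the INVERSE
IMAGE OF PRINT'S `D̄_x`: for ANY homomorphic section `s : G_K → Π^tp_X` of `aug` (Prop. 2.2 (ii)'s torsor of splittings is then
visibly non-empty),
* §1 **`PiCData.coverDataAxOfSection I l e hodd s hsa hιell hιtheta : CoverDataAx l`** with
  **`Dx := barTheta l ⊔ incl(toHat(s(G_K)))`** — the three `Dx`-clauses PROVED (`sectionDx_le_PiX`, `augGK_sectionDx_surjective`,
  `sectionDx_inf_ker_sup_barKer`), everything else verbatim from gen 4 (`e : OncePuncturedData` supplies the `Δ_X`-side facts);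
  binders = {hιell, hιtheta} only (NO hIx, NO cusp `x`); `S := incl(toHat(s(G_K))) ⊔ barKer` is an `IsSplitting` of it
  (`isSplitting_sectionSplitting`), closed for continuous `s` (abc-iut-L2-d3's `isClosed_splittingOfSection`); [EtTh] Prop. 2.2
  (i)(ii)(iii) hold for it (gen 2–3's `CoverDataAx.prop22_*_holds`);
* §2 **INSTANCE at abc-iut-w5-d140's KUMMER-CARRYING cusped inversion model `MuTwoSetting.inversionModelχ′`**
  (`coverDataAxInvχ'`: `I := (cLevelDataInvχ' p).piCData`, `s := inr` on `G_K = G_{ℚ_p}`, hιell / hιtheta = p443309's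
  `inv_ell/inv_theta_piCData_inversionModelχ'` BY NAME, `e :=` abc-iut-w5-d111's once-punctured parameters) ⇒ census headline
  `MuTwoSetting.exists_kummerData_cLevelData_coverDataAx`: **`KummerData`, `CLevelData` and a `CoverDataAx` with every binder a
  theorem JOINTLY at ONE model** (`nonempty_kummerData_modelχ'`, abc-iut-w5-d171) — the combination gen 6's 12:52Z census line
  had reserved to a twisted carrier (that line concerned the GEOMETRIC `Dx`, whose hIx stays false at χ′).
HONEST LIMITS: the `Dx` of §2 is a SYNTHETIC mod-`l` cusp datum — the inverse image of `Δ̄_Θ · s(G_K)`, NOT the decomposition group of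
the model's point (whose inertia is toral); semi-synthetic model = consistency evidence for the typed interface only. Class (b)
construction file: definitions `PiCData.sectionRange`, `PiCData.sectionDx`, `PiCData.coverDataAxOfSection`, `SettingModel.sectionχ'`,
`SettingModel.coverDataAxInvχ'`; no instance, no `Prop` fact, no interface clause touched; nothing of [EtTh] asserted; no side taken on
[IUTchIII] Cor. 3.12; typed ≠ proved; instantiated ≠ endorsed.
-/

noncomputable section

namespace Literature.AnabelianGeometry.EtaleTheta

namespace ThetaSetting

namespace PiCData

open Literature.AnabelianGeometry.SemiGraphs ThetaCovers
open scoped Pointwise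

variable {p : ℕ} [Fact p.Prime] {D : ThetaSetting p} {PiC : Type} [Group PiC] [TopologicalSpace PiC]
  [IsTopologicalGroup PiC] [T2Space PiC] (I : D.PiCData PiC) (l : ℕ)

/-! ## §1. The cusp datum from a section -/

/-- **`incl(toHat(s(G_K))) ⊆ Π_C`** — the image in `Π_C` of a section `s : G_K → Π^tp_X` (the complement of `Δ̄_Θ` in print's
`D̄_x`, p. 35). DEFINED. [cite: MochizukiEtTh2009, Def 2.1 p.35] -/
def sectionRange (s : ↥D.GK →* D.PiTemp) : Subgroup PiC := (I.incl.toMonoidHom.comp (D.toHat.toMonoidHom.comp s)).range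

/-- [cite: MochizukiEtTh2009, Def 2.1 p.35] -/
theorem mem_sectionRange_iff (s : ↥D.GK →* D.PiTemp) (g : PiC) :
    g ∈ I.sectionRange s ↔ ∃ σ : ↥D.GK, I.incl (D.toHat (s σ)) = g := Iff.rfl

/-- `incl(toHat(s σ))` lies in the section image. [cite: MochizukiEtTh2009, Def 2.1 p.35] -/
theorem incl_toHat_section_mem (s : ↥D.GK →* D.PiTemp) (σ : ↥D.GK) : I.incl (D.toHat (s σ)) ∈ I.sectionRange s :=
  ⟨σ, rfl⟩

/-- The section image lies in `Π_X`. [cite: MochizukiEtTh2009, Def 2.1 p.35] -/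
theorem sectionRange_le_PiX (s : ↥D.GK →* D.PiTemp) : I.sectionRange s ≤ I.PiX := by
  rintro _ ⟨σ, rfl⟩
  exact ⟨D.toHat (s σ), rfl⟩

/-- **`D̄_x`-preimage := `Δ̄_Θ`-preimage `·` `incl(toHat(s(G_K)))`** — the inverse image in `Π_C` of print's
`1 → Δ̄_Θ → D̄_x → G_K → 1` split by `s`. DEFINED. [cite: MochizukiEtTh2009, Def 2.1 p.35] -/
def sectionDx (s : ↥D.GK →* D.PiTemp) : Subgroup PiC := I.barTheta l ⊔ I.sectionRange s

/-- `D̄_x`-preimage `≤ Π_X`. [cite: MochizukiEtTh2009, Def 2.1 p.35] -/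
theorem sectionDx_le_PiX (e : D.OncePuncturedData) (s : ↥D.GK →* D.PiTemp) : I.sectionDx l s ≤ I.PiX :=
  sup_le (fun _ hg => (I.barTheta_le l e hg).1) (I.sectionRange_le_PiX s)

/-- **`D̄_x ↠ G_K`** through the section: `aug (incl (toHat (s σ))) = σ`. [cite: MochizukiEtTh2009, Def 2.1 p.35] -/
theorem augGK_sectionDx_surjective (s : ↥D.GK →* D.PiTemp) (hsa : ∀ σ, D.aug (s σ) = (σ : GQp p)) :
    Function.Surjective (I.augGK.restrict (I.sectionDx l s)) := by
  intro σ
  refine ⟨⟨I.incl (D.toHat (s σ)), Subgroup.mem_sup_right (I.incl_toHat_section_mem s σ)⟩, Subtype.ext ?_⟩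
  rw [MonoidHom.restrict_apply, coe_augGK_apply]
  exact I.aug_incl_toHat_section s hsa σ

/-- The geometric part of the `D̄_x`-preimage IS the `Δ̄_Θ`-preimage: an element `t · incl(toHat(s σ))` with trivial augmentation
has `σ = 1`. [cite: MochizukiEtTh2009, Def 2.1 p.35] -/
theorem sectionDx_inf_ker_le (e : D.OncePuncturedData) (s : ↥D.GK →* D.PiTemp) (hsa : ∀ σ, D.aug (s σ) = (σ : GQp p)) :
    I.sectionDx l s ⊓ I.augGK.ker ≤ I.barTheta l := by
  haveI : (I.barTheta l).Normal := I.barTheta_normal l e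
  rintro g ⟨hgD, hgK⟩
  have hg' : g ∈ ((I.barTheta l : Set PiC) * (I.sectionRange s : Set PiC)) := by
    rw [← Subgroup.normal_mul]; exact hgD
  obtain ⟨t, ht, _, ⟨σ, rfl⟩, rfl⟩ := hg'
  have ht1 : I.aug t = 1 := I.mem_ker_augGK.mp (I.barTheta_le l e ht).2
  have hσ : (σ : GQp p) = 1 := by
    have h := I.mem_ker_augGK.mp hgK
    rw [map_mul, ht1, one_mul] at h
    change I.aug (I.incl (D.toHat (s σ))) = 1 at h
    rwa [I.aug_incl_toHat_section s hsa σ] at h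
  have hσ1 : σ = 1 := Subtype.ext hσ
  change t * I.incl (D.toHat (s σ)) ∈ I.barTheta l
  rw [hσ1, map_one, map_one, map_one, mul_one]
  exact ht

/-- **«`I_x` maps isomorphically onto `Δ̄_Θ`» for the `D̄_x`-preimage, AS A THEOREM**: `(Dx ⊓ Ker aug) ⊔ barKer = barTheta` — the
`CoverData` clause `inertia_sup_barKer` with no hIx binder. [cite: MochizukiEtTh2009, Def 2.1 p.35] -/
theorem sectionDx_inf_ker_sup_barKer (e : D.OncePuncturedData) (s : ↥D.GK →* D.PiTemp)
    (hsa : ∀ σ, D.aug (s σ) = (σ : GQp p)) :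
    (I.sectionDx l s ⊓ I.augGK.ker) ⊔ I.barKer l = I.barTheta l :=
  le_antisymm (sup_le (I.sectionDx_inf_ker_le l e s hsa) (I.barKer_le_barTheta l e))
    (le_sup_of_le_left (le_inf le_sup_left fun _ hg => (I.barTheta_le l e hg).2))

/-- **The `CoverDataAx` of an [EtTh] §1 theta setting FROM A SECTION** `s : G_K → Π^tp_X` of `aug`: gen 4's `coverDataAx`
verbatim except `Dx := barTheta l ⊔ incl(toHat(s(G_K)))` (the `D̄_x`-preimage) with its three clauses PROVED — binders = {hιell,
hιtheta} ONLY (no hIx, no cusp). DEFINED. [cite: MochizukiEtTh2009, Def 2.1 p.36] -/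
def coverDataAxOfSection (e : D.OncePuncturedData) (hodd : Odd l) (s : ↥D.GK →* D.PiTemp)
    (hsa : ∀ σ, D.aug (s σ) = (σ : GQp p))
    (hιell : ∀ c ∈ I.augGK.ker, c ∉ I.PiX → ∀ d ∈ I.PiX ⊓ I.augGK.ker, c * d * c⁻¹ * d ∈ I.barTheta l)
    (hιtheta : ∀ c ∈ I.augGK.ker, c ∉ I.PiX → ∀ t ∈ I.barTheta l, c * t * c⁻¹ * t⁻¹ ∈ I.barKer l) :
    CoverDataAx.{0} l :=
  haveI : NeZero l := ⟨by obtain ⟨k, hk⟩ := hodd; omega⟩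
  haveI : (I.barTheta l).Normal := I.barTheta_normal l e
  { l_odd := hodd
    PiC := PiC
    GK := ↥D.GK
    aug := I.augGK
    PiX := I.PiX
    PiX_normal := I.range_normal
    index_PiX := I.index_range
    isOpen_PiX := I.isOpen_PiX
    aug_PiX_surjective := I.augGK_PiX_surjective
    barKer := I.barKer l
    barKer_normal := I.barKer_normal l e
    isClosed_barKer := I.isClosed_barKer l
    barTheta := I.barTheta l
    barTheta_normal := I.barTheta_normal l e
    barKer_le_barTheta := I.barKer_le_barTheta l e
    barTheta_le := I.barTheta_le l e
    relIndex_barKer := I.relIndex_barKer l e hodd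
    ell_rank_two := I.ell_rank_two l e
    barTheta_central := I.barTheta_central l e
    Dx := I.sectionDx l s
    Dx_le := I.sectionDx_le_PiX l e s
    aug_Dx_surjective := I.augGK_sectionDx_surjective l s hsa
    inertia_sup_barKer := I.sectionDx_inf_ker_sup_barKer l e s hsa
    pow_mem_barKer := fun _ hd => I.pow_mem_barKer l e hd
    inv_ell := hιell
    inv_theta := hιtheta }

/-- Bookkeeping (`rfl`): `Π_C`, `Π_X`, `barKer`, `barTheta`, `D_x` of `coverDataAxOfSection`.
[cite: MochizukiEtTh2009, Def 2.1 p.36] -/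
theorem coverDataAxOfSection_fields (e : D.OncePuncturedData) (hodd : Odd l) (s : ↥D.GK →* D.PiTemp)
    (hsa : ∀ σ, D.aug (s σ) = (σ : GQp p))
    (hιell : ∀ c ∈ I.augGK.ker, c ∉ I.PiX → ∀ d ∈ I.PiX ⊓ I.augGK.ker, c * d * c⁻¹ * d ∈ I.barTheta l)
    (hιtheta : ∀ c ∈ I.augGK.ker, c ∉ I.PiX → ∀ t ∈ I.barTheta l, c * t * c⁻¹ * t⁻¹ ∈ I.barKer l) :
    (I.coverDataAxOfSection l e hodd s hsa hιell hιtheta).PiX = I.PiX ∧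
      (I.coverDataAxOfSection l e hodd s hsa hιell hιtheta).barKer = I.barKer l ∧
      (I.coverDataAxOfSection l e hodd s hsa hιell hιtheta).barTheta = I.barTheta l ∧
      (I.coverDataAxOfSection l e hodd s hsa hιell hιtheta).Dx = I.barTheta l ⊔ I.sectionRange s :=
  ⟨rfl, rfl, rfl, rfl⟩

/-- **The section's own splitting**: `S := incl(toHat(s(G_K))) · Ker` is an `IsSplitting` of `coverDataAxOfSection`
(`Ker ≤ S ≤ D_x·Ker`, `S ∩ Δ̄_Θ-preimage = Ker`, `S ↠ G_K`) — Prop. 2.2 (ii)'s torsor of splittings is non-empty here with no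
cusp hypothesis (abc-iut-L2-d3's `isSplitting_of_section` argument, `Dx`-clause now trivial). [cite: MochizukiEtTh2009, Prop 2.2(ii) p.37] -/
theorem isSplitting_sectionSplitting (e : D.OncePuncturedData) (hodd : Odd l) (s : ↥D.GK →* D.PiTemp)
    (hsa : ∀ σ, D.aug (s σ) = (σ : GQp p))
    (hιell : ∀ c ∈ I.augGK.ker, c ∉ I.PiX → ∀ d ∈ I.PiX ⊓ I.augGK.ker, c * d * c⁻¹ * d ∈ I.barTheta l)
    (hιtheta : ∀ c ∈ I.augGK.ker, c ∉ I.PiX → ∀ t ∈ I.barTheta l, c * t * c⁻¹ * t⁻¹ ∈ I.barKer l) :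
    (I.coverDataAxOfSection l e hodd s hsa hιell hιtheta).toCoverData.IsSplitting (I.sectionRange s ⊔ I.barKer l) := by
  haveI : (I.barKer l).Normal := I.barKer_normal l e
  have haug1 : ∀ g ∈ I.barTheta l, I.aug g = 1 := fun g hg => I.mem_ker_augGK.mp (I.barTheta_le l e hg).2
  refine
    { barKer_le := le_sup_right
      le := sup_le_sup_right le_sup_right _
      inf_eq := ?_
      surj := ?_ }
  · show (I.sectionRange s ⊔ I.barKer l) ⊓ I.barTheta l = I.barKer l
    refine le_antisymm ?_ (le_inf le_sup_right (I.barKer_le_barTheta l e))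
    rintro g ⟨hgS, hgT⟩
    have hg' : g ∈ ((I.sectionRange s : Set PiC) * (I.barKer l : Set PiC)) := by
      rw [← Subgroup.mul_normal]; exact hgS
    obtain ⟨_, ⟨σ, rfl⟩, n, hn, rfl⟩ := hg'
    have hn1 : I.aug n = 1 := haug1 n (I.barKer_le_barTheta l e hn)
    have hσ : (σ : GQp p) = 1 := by
      rw [← I.aug_incl_toHat_section s hsa σ]
      have h := haug1 _ hgT
      rw [map_mul, hn1, mul_one] at h
      exact h
    have hσ1 : σ = 1 := Subtype.ext hσ
    change I.incl (D.toHat (s σ)) * n ∈ I.barKer l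
    rw [hσ1, map_one, map_one, map_one, one_mul]
    exact hn
  · rintro (σ : ↥D.GK)
    refine ⟨⟨I.incl (D.toHat (s σ)), Subgroup.mem_sup_left (I.incl_toHat_section_mem s σ)⟩, Subtype.ext ?_⟩
    show ((I.augGK (I.incl (D.toHat (s σ))) : D.GK) : GQp p) = (σ : GQp p)
    rw [coe_augGK_apply, I.aug_incl_toHat_section s hsa]

/-- **A continuous section gives a CLOSED splitting** of `coverDataAxOfSection` — the binder pair (`hS`, `hSc`) of
abc-iut-L2-d3's `temperedCoverData`-type assemblies, with NO cusp hypothesis (closedness: abc-iut-L2-d3's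
`isClosed_splittingOfSection`, same subgroup up to `sup_comm`). [cite: MochizukiEtTh2009, Prop 2.2(ii) p.37] -/
theorem exists_isSplitting_isClosed_ofSection (e : D.OncePuncturedData) (hodd : Odd l) (s : ↥D.GK →* D.PiTemp)
    (hsa : ∀ σ, D.aug (s σ) = (σ : GQp p)) (hsc : Continuous s)
    (hιell : ∀ c ∈ I.augGK.ker, c ∉ I.PiX → ∀ d ∈ I.PiX ⊓ I.augGK.ker, c * d * c⁻¹ * d ∈ I.barTheta l)
    (hιtheta : ∀ c ∈ I.augGK.ker, c ∉ I.PiX → ∀ t ∈ I.barTheta l, c * t * c⁻¹ * t⁻¹ ∈ I.barKer l) :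
    ∃ S : Subgroup PiC, (I.coverDataAxOfSection l e hodd s hsa hιell hιtheta).toCoverData.IsSplitting S ∧
      IsClosed (S : Set PiC) :=
  ⟨_, I.isSplitting_sectionSplitting l e hodd s hsa hιell hιtheta, I.isClosed_splittingOfSection l e s hsc⟩

/-- **[EtTh] Prop. 2.2 (i)(ii)(iii) for `coverDataAxOfSection`** (gen 2–3's `CoverDataAx.prop22_*_holds`).
[cite: MochizukiEtTh2009, Prop 2.2 p.37] -/
theorem prop22_ofSection (e : D.OncePuncturedData) (hodd : Odd l) (s : ↥D.GK →* D.PiTemp)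
    (hsa : ∀ σ, D.aug (s σ) = (σ : GQp p))
    (hιell : ∀ c ∈ I.augGK.ker, c ∉ I.PiX → ∀ d ∈ I.PiX ⊓ I.augGK.ker, c * d * c⁻¹ * d ∈ I.barTheta l)
    (hιtheta : ∀ c ∈ I.augGK.ker, c ∉ I.PiX → ∀ t ∈ I.barTheta l, c * t * c⁻¹ * t⁻¹ ∈ I.barKer l) :
    (I.coverDataAxOfSection l e hodd s hsa hιell hιtheta).toCoverData.Prop22_i ∧
      (I.coverDataAxOfSection l e hodd s hsa hιell hιtheta).toCoverData.Prop22_ii ∧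
      (I.coverDataAxOfSection l e hodd s hsa hιell hιtheta).toCoverData.Prop22_iii :=
  ⟨(I.coverDataAxOfSection l e hodd s hsa hιell hιtheta).prop22_i_holds,
    (I.coverDataAxOfSection l e hodd s hsa hιell hιtheta).prop22_ii_holds,
    (I.coverDataAxOfSection l e hodd s hsa hιell hιtheta).prop22_iii_holds⟩

end PiCData

end ThetaSetting

/-! ### At a `MuTwoSetting` C-level record: the section datum lies below `Π_X̲` (Def. 2.1's «`D_x → Q` is trivial») -/

namespace MuTwoSetting.CLevelData

open Literature.AnabelianGeometry.SemiGraphs ThetaCovers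

variable {p : ℕ} [Fact p.Prime] {M : MuTwoSetting p}
variable {PC : Type} [Group PC] [TopologicalSpace PC] [IsTopologicalGroup PC] [T2Space PC]

/-- **`D̄_x`-preimage `≤ Π_X̲ := cl(ιC(inclX(Π^tp_X̲)))`** for a section `s` valued in `Π^tp_Y = Ker toZ` (e.g. the Galois
section of a model): the `Dx_le` clause of abc-iut-L2-t2's `IsTypeLTors` (Def. 2.1 «the restricted map `D_x → Q` is trivial») for
the section datum — so abc-iut-L2-d3's `isTypeLTors_ofSetting` / `exists_PiCuu_ofSetting'` chain replays for `coverDataAxOfSection`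
with this one field swapped (`barTheta_le_closureXu` is theirs). [cite: MochizukiEtTh2009, Def 2.1 p.36] -/
theorem sectionDx_le_closureXu (e : M.CLevelData) (ιC : M.GtpC →ₜ* PC) (hιC : IsProfiniteCompletion ιC)
    (op : M.toThetaSetting.OncePuncturedData) (l : ℕ) [NeZero l] (s : ↥M.GK →* M.PiTemp) (hsZ : ∀ σ, M.toZ (s σ) = 1) :
    (e.piCDataOf ιC hιC).sectionDx l s ≤ (((M.GtpXu l).map M.inclX).map ιC.toMonoidHom).topologicalClosure := by
  refine sup_le (e.barTheta_le_closureXu ιC hιC op l) ?_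
  rintro _ ⟨σ, rfl⟩
  change (e.piCDataOf ιC hιC).incl (M.toHat (s σ)) ∈ _
  rw [e.piCDataOf_incl_toHat ιC hιC (s σ)]
  refine Subgroup.le_topologicalClosure _ ⟨M.inclX (s σ), ⟨s σ, ?_, rfl⟩, rfl⟩
  change s σ ∈ (ThetaSetting.lZ l).comap M.toZ
  rw [Subgroup.mem_comap, hsZ]
  exact one_mem _

end MuTwoSetting.CLevelData

/-! ## §2. Instance at the Kummer-carrying cusped inversion model `χ′` -/

namespace SettingModel

open Literature.AnabelianGeometry.SemiGraphs ThetaCovers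
open _root_.Topology

variable (p : ℕ) [Fact p.Prime]

/-- **The Galois section of the χ-models**: `G_K = G_{ℚ_p} → Π^tp_X = Γ ⋊_χ G_{ℚ_p}`, `σ ↦ (1, σ)` (restricted to the subgroup
`G_K`). DEFINED. [cite: MochizukiEtTh2009, §1 p.12] -/
def sectionχ' : ↥(ThetaSetting.modelχ' p).GK →* (ThetaSetting.modelχ' p).PiTemp :=
  (SemidirectProduct.inr : GQp p →* PiTpχ p).comp (ThetaSetting.modelχ' p).GK.subtype

/-- It is a section of `aug`. [cite: MochizukiEtTh2009, §1 p.12] -/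
theorem aug_sectionχ' (σ : ↥(ThetaSetting.modelχ' p).GK) : (ThetaSetting.modelχ' p).aug (sectionχ' p σ) = (σ : GQp p) := rfl

/-- It is continuous. [cite: MochizukiEtTh2009, §1 p.12] -/
theorem continuous_sectionχ' : Continuous (sectionχ' p) :=
  (continuous_inrχ p).comp continuous_subtype_val

/-- It is valued in `Π^tp_Y = Ker toZ` (the degree of `(1, σ)` is `0`). [cite: MochizukiEtTh2009, §1 p.12] -/
theorem toZ_sectionχ' (σ : ↥(ThetaSetting.modelχ' p).GK) : (ThetaSetting.modelχ' p).toZ (sectionχ' p σ) = 1 := by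
  change gfpSnd (SemidirectProduct.inr (σ : GQp p) : PiTpχ p).left = 1
  rw [SemidirectProduct.left_inr, map_one]

/-- **`CoverDataAx l` at `MuTwoSetting.inversionModelχ′` with EVERY binder a theorem** (odd `l`): the section constructor over
abc-iut-L2-d3's derived bundle `(cLevelDataInvχ' p).piCData`, with hιell / hιtheta = abc-iut-w5-d140's
`inv_ell/inv_theta_piCData_inversionModelχ'` and the once-punctured parameters of `modelχ′`; `Dx` = the SYNTHETIC mod-`l` cusp datum
(honest label: not the decomposition group of the model's toral cusp, for which hIx fails). DEFINED. [cite: MochizukiEtTh2009, Def 2.1 p.36] -/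
def coverDataAxInvχ' (l : ℕ) (hodd : Odd l) : CoverDataAx.{0} l :=
  let eX := (nonempty_oncePuncturedData_modelχ' p).some
  (cLevelDataInvχ' p).piCData.coverDataAxOfSection l eX hodd (sectionχ' p) (aug_sectionχ' p)
    (inv_ell_piCData_inversionModelχ' p l eX) (inv_theta_piCData_inversionModelχ' p l eX)

/-- **[EtTh] Prop. 2.2 (i)(ii)(iii) INSTANTIATED at the Kummer-carrying `inversionModelχ′`.** [cite: MochizukiEtTh2009, Prop 2.2 p.37] -/
theorem prop22_coverDataAxInvχ' (l : ℕ) (hodd : Odd l) :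
    (coverDataAxInvχ' p l hodd).toCoverData.Prop22_i ∧ (coverDataAxInvχ' p l hodd).toCoverData.Prop22_ii ∧
      (coverDataAxInvχ' p l hodd).toCoverData.Prop22_iii :=
  ⟨(coverDataAxInvχ' p l hodd).prop22_i_holds, (coverDataAxInvχ' p l hodd).prop22_ii_holds,
    (coverDataAxInvχ' p l hodd).prop22_iii_holds⟩

/-- A CLOSED splitting of `coverDataAxInvχ′` exists (the Galois section is continuous) — the (`hS`, `hSc`) inputs of a tempered
assembly over it. [cite: MochizukiEtTh2009, Prop 2.2(ii) p.37] -/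
theorem exists_isSplitting_isClosed_coverDataAxInvχ' (l : ℕ) (hodd : Odd l) :
    ∃ S : Subgroup (cLevelDataInvχ' p).PiCHat, (coverDataAxInvχ' p l hodd).toCoverData.IsSplitting S ∧
      IsClosed (S : Set (cLevelDataInvχ' p).PiCHat) :=
  (cLevelDataInvχ' p).piCData.exists_isSplitting_isClosed_ofSection l (nonempty_oncePuncturedData_modelχ' p).some hodd
    (sectionχ' p) (aug_sectionχ' p) (continuous_sectionχ' p)
    (inv_ell_piCData_inversionModelχ' p l (nonempty_oncePuncturedData_modelχ' p).some)
    (inv_theta_piCData_inversionModelχ' p l (nonempty_oncePuncturedData_modelχ' p).some)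

/-- **CENSUS HEADLINE.** `KummerData` (abc-iut-w5-d171 `nonempty_kummerData_modelχ'`), `CLevelData` (abc-iut-w5-d140
`cLevelDataInvχ'`) and a `ThetaCovers.CoverDataAx l` whose `Π_C ⊇ Π_X ↠ G_K` is the one DERIVED from the tempered `Π^tp_C` and whose
binders hιell / hιtheta are theorems, are JOINTLY available at ONE model — the cusped inversion model over the χ-twisted root — for
every odd `l` (with the mod-`l` cusp datum of a section). [cite: MochizukiEtTh2009, Def 2.1 p.36] -/
theorem _root_.Literature.AnabelianGeometry.EtaleTheta.MuTwoSetting.exists_kummerData_cLevelData_coverDataAx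
    (l : ℕ) (hodd : Odd l) :
    ∃ (M : MuTwoSetting p) (e : M.CLevelData), Nonempty M.toThetaSetting.KummerData ∧ M.toThetaSetting.IsEtThOrigin ∧
      ∃ X : CoverDataAx.{0} l, X.PiC = e.PiCHat ∧ X.toCoverData.Prop22_i ∧ X.toCoverData.Prop22_ii ∧ X.toCoverData.Prop22_iii :=
  ⟨MuTwoSetting.inversionModelχ' p, cLevelDataInvχ' p, nonempty_kummerData_modelχ' p,
    MuTwoSetting.inversionModelχ'_isEtThOrigin p, coverDataAxInvχ' p l hodd, rfl, prop22_coverDataAxInvχ' p l hodd⟩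

end SettingModel

end Literature.AnabelianGeometry.EtaleTheta

end
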